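import Summits.KontsevichZagierPeriods.KontsevichZagierPeriods.Theorems.SoloInformedCuspDatum

/-!
# Cusp pieces of a semialgebraic arc are `κ̃` of Nash symbols (Rung 2, file E4d)

Solo programme `solo-KontsevichZagierPeriods-informed`, step L4 of `paper/rung2-v2.md`.

For a cusp piece `P` (file E4c) and an admissible rational far end `q` (`κ = ϵ (q − c₀) > 0`,
`4 κ^{1/n} < r`), the étale datum of file E4c is a Nash symbol `σ` — the real and imaginary parts
of `ρ̃(κ^{1/n} t²)` are `ℚ`-semialgebraic by the germ identity, the pull-back of `g` along the
power map and polynomial algebra — and its period integrand is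
`g(c₀ + ϵ κ t^{2n}) · 2n κ t^{2n−1}` (real), whence

`κ̃(σ) = (⟦[side(c₀, q), g]⟧, 0)`  (`SoloInformedCuspPiece.kappaTilde_eq`)

by one Kontsevich–Zagier change of variables `t ↦ c₀ + ϵ κ t^{2n}` (file E4a) after discarding the
null end points. [Huber–Wüstholz 2022, §13.1; Kontsevich–Zagier 2001, §1.2]
-/

noncomputable section

open Set Filter Topology MeasureTheory Metric
open scoped Polynomial
open Literature.NumberTheory.Transcendental Literature.NumberTheory.Transcendental.KZ
open Literature.NumberTheory.Transcendental.CurvePeriods Literature.ModelTheory.ExponentialFields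

namespace Summit.KontsevichZagierPeriods.KontsevichZagierPeriods.Theorems

namespace SoloInformedCuspPiece

variable {P : SoloInformedCuspPiece} {q : ℚ} (hq : P.Admissible q)
include hq

/-! ## 1. Semialgebraic real and imaginary parts -/

/-- Real and imaginary parts of `s` are semialgebraic. -/
theorem reImSA_s {S : Set (Fin 1 → ℝ)} (hS : IsSemialgebraic ℚ S) :
    SoloInformedReImSA S (fun x => (datum hq).s (x 0)) := by
  have h : IsSemialgebraicFunOn ℚ S (fun x : Fin 1 → ℝ => P.s₂ q * (x 0) ^ 2) := by
    have h1 := isSemialgebraicFunOn_const_of_isAlgebraic hS (s₂_alg hq)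
    have h0 : IsSemialgebraicFunOn ℚ S (fun x : Fin 1 → ℝ => x 0) :=
      (isSemialgebraicFunOn_aeval hS (MvPolynomial.X 0 : MvPolynomial (Fin 1) ℚ)).congr
        fun x _ => by simp
    exact (IsSemialgebraicFunOn.mul_holds h1 (IsSemialgebraicFunOn.mul_holds h0 h0)).congr
      fun x _ => by simp only [Pi.mul_apply]; ring
  exact soloInformed_reImSA_ofReal hS h

/-- On `S ∩ {t ≠ 0}`: real and imaginary parts of `Y = ρ̃ ∘ s` are semialgebraic (germ identity,
pull-back of `g` along the power map, polynomial algebra). -/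
theorem reImSA_Y_ne : SoloInformedReImSA (S1 ∩ {x | x 0 ≠ 0}) (fun x => (datum hq).Y (x 0)) := by
  have hne : IsSemialgebraic ℚ {x : Fin 1 → ℝ | x 0 ≠ 0} := by
    have h : {x : Fin 1 → ℝ | x 0 ≠ 0} = {x | x 0 < 0} ∪ {x | (0 : ℝ) < x 0} := by
      ext x
      simp only [mem_setOf_eq, mem_union]
      exact lt_or_lt_iff_ne.symm
    rw [h]
    exact (isSemialgebraic_setOf_apply_lt_const isAlgebraic_zero 0).union
      (isSemialgebraic_setOf_const_lt_apply isAlgebraic_zero 0)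
  have hS : IsSemialgebraic ℚ (S1 ∩ {x : Fin 1 → ℝ | x 0 ≠ 0}) :=
    (soloInformed_isSemialgebraic_margin 1).inter hne
  -- the pull-back of `g`
  set Φ := soloInformedPowMap P.c₀ (P.κ q) P.ϵ (2 * P.germ.n) with hΦ
  have hmaps : MapsTo Φ (S1 ∩ {x | x 0 ≠ 0}) P.ρ.domain := by
    intro x hx
    have hu := mem_Ioo hq hx.1 hx.2
    have hpow : (P.s₂ q * x 0 ^ 2) ^ P.germ.n = P.κ q * x 0 ^ (2 * P.germ.n) := by
      rw [mul_pow, s₂_pow hq, ← pow_mul]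
    have hη := P.germ.pow_lt _ hu
    have hside := P.side _ ⟨pow_pos hu.1 _, hη⟩
    rw [P.dom, soloInformed_mem_Ioo1, hΦ, soloInformedPowMap_apply]
    rw [hpow] at hside
    convert hside using 1
    ring
  have hg : IsSemialgebraicFunOn ℚ (S1 ∩ {x | x 0 ≠ 0})
      (fun x => P.g (P.c₀ + P.ϵ * P.κ q * (x 0) ^ (2 * P.germ.n))) := by
    have h := IsSemialgebraicFunOn.comp_isSemialgebraicMapOn_holds
      P.ρ.isSemialgebraicFunOn_integrand
      (soloInformed_isSemialgebraicMapOn_powMap hS P.c₀_alg (P.κ_alg q) P.ϵ (2 * P.germ.n)) hmaps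
    refine h.congr fun x _ => ?_
    show P.ρ.integrand (Φ x) = _
    rw [soloInformed_integrand_eq_arcFun, hΦ, soloInformedPowMap_apply]
    rfl
  have hs := reImSA_s hq hS
  have hU : SoloInformedReImSA (S1 ∩ {x | x 0 ≠ 0}) (fun x =>
      Polynomial.eval₂ (algebraMap SoloInformedQbar ℂ) ((datum hq).s (x 0)) P.germ.U) := by
    have h := SoloInformedEtaleDatum.re_im_evC soloInformed_hK_Qbar (Polynomial.C P.germ.U) hS hs
      (SoloInformedReImSA.const hS isAlgebraic_zero)
    refine SoloInformedReImSA.congr h fun x _ => ?_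
    simp [soloInformedEvC]
  have hsm : SoloInformedReImSA (S1 ∩ {x | x 0 ≠ 0}) (fun x => (datum hq).s (x 0) ^ P.germ.m) :=
    re_im_pow hS hs _
  have h := re_im_div (re_im_sub (soloInformed_reImSA_ofReal hS hg) hU) hsm fun x hx =>
    pow_ne_zero _ (by
      show (((P.s₂ q * x 0 ^ 2 : ℝ)) : ℂ) ≠ 0
      exact_mod_cast (mem_Ioo hq hx.1 hx.2).1.ne')
  exact SoloInformedReImSA.congr h fun x hx => (ρ_eq hq hx.1 hx.2).symm

/-- On `S ∩ {t = 0}`: `Y = ρ̃(0) = w₀` is an algebraic constant. -/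
theorem reImSA_Y_eq : SoloInformedReImSA (S1 ∩ {x | x 0 = 0}) (fun x => (datum hq).Y (x 0)) := by
  have hS : IsSemialgebraic ℚ (S1 ∩ {x : Fin 1 → ℝ | x 0 = 0}) :=
    (soloInformed_isSemialgebraic_margin 1).inter
      (isSemialgebraic_setOf_apply_eq_of_isAlgebraic isAlgebraic_zero 0)
  refine (SoloInformedReImSA.const hS (soloInformed_hK_Qbar P.germ.w₀)).congr fun x hx => ?_
  show _ = P.germ.ρ _
  rw [show x 0 = 0 from hx.2]
  norm_num
  rw [P.germ.ρ_zero]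
  rfl

/-- Real and imaginary parts of `Y` are semialgebraic on `S`. -/
theorem reImSA_Y : SoloInformedReImSA S1 (fun x => (datum hq).Y (x 0)) := by
  classical
  have h1 := reImSA_Y_ne hq
  have h0 := reImSA_Y_eq hq
  have hsub : S1 ⊆ (S1 ∩ {x : Fin 1 → ℝ | x 0 ≠ 0}) ∪ (S1 ∩ {x | x 0 = 0}) := fun x hx => by
    by_cases h : x 0 = 0
    · exact Or.inr ⟨hx, h⟩
    · exact Or.inl ⟨hx, h⟩
  exact ⟨(IsSemialgebraicFunOn.union h1.1 h0.1 (fun _ _ => rfl) (fun _ _ => rfl)).mono hsub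
      (soloInformed_isSemialgebraic_margin 1),
    (IsSemialgebraicFunOn.union h1.2 h0.2 (fun _ _ => rfl) (fun _ _ => rfl)).mono hsub
      (soloInformed_isSemialgebraic_margin 1)⟩

/-- **The path of a cusp piece is a Nash path.** -/
theorem nash : SoloInformedIsNashPath (symbol hq).γ.toFun :=
  ⟨1, one_pos, (datum hq).contDiffOn_path, fun i => (datum hq).re_im_path soloInformed_hK_Qbar
    (soloInformed_isSemialgebraic_margin 1) (fun _ hx => hx)
    (reImSA_s hq (soloInformed_isSemialgebraic_margin 1)) (reImSA_Y hq) i⟩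

/-! ## 2. The period integrand and `κ̃` -/

/-- `H(u, w) = (U(u) + u^m w) · n u^{n−1}`. -/
theorem evC_H (u w : ℂ) : soloInformedEvC (datum hq).H u w =
    (Polynomial.eval₂ (algebraMap SoloInformedQbar ℂ) u P.germ.U + u ^ P.germ.m * w) *
      ((P.germ.n : ℂ) * u ^ (P.germ.n - 1)) := by
  simp [datum, soloInformedEvC]

/-- `s′(t) = 2 s₂ t` (complexified). -/
theorem hasDerivAt_s (t : ℝ) :
    HasDerivAt (datum hq).s (((P.s₂ q * (2 * t) : ℝ)) : ℂ) t := by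
  have h : HasDerivAt (fun t : ℝ => P.s₂ q * t ^ 2) (P.s₂ q * (2 * t)) t := by
    have := (hasDerivAt_pow 2 t).const_mul (P.s₂ q)
    simpa using this
  exact h.ofReal_comp

/-- **The period integrand of a cusp piece** at `0 < t < 2`:
`H(γ) s′ = g(c₀ + ϵ κ t^{2n}) · (2n) κ t^{2n−1}` (real). -/
theorem pathIntegrand_eq {t : ℝ} (ht : t ∈ Ioo (-((1 : ℚ) : ℝ)) (1 + (1 : ℚ))) (ht0 : t ≠ 0) :
    soloInformedPathIntegrand (symbol hq) t =
      (((P.g (P.c₀ + P.ϵ * P.κ q * t ^ (2 * P.germ.n)) *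
        (((2 * P.germ.n : ℕ) : ℝ) * P.κ q * t ^ (2 * P.germ.n - 1)) : ℝ)) : ℂ) := by
  unfold soloInformedPathIntegrand
  rw [(datum hq).symbol_integrand soloInformed_hK_Qbar, (hasDerivAt_s hq t).deriv, evC_H]
  have hs : (datum hq).s t = ((P.s₂ q * t ^ 2 : ℝ) : ℂ) := rfl
  have hY : (datum hq).Y t = P.germ.ρ ((P.s₂ q * t ^ 2 : ℝ) : ℂ) := rfl
  rw [hs, hY]
  have hu := mem_Ioo hq ht ht0
  have h := P.germ.real _ hu
  have hpow : (P.s₂ q * t ^ 2) ^ P.germ.n = P.κ q * t ^ (2 * P.germ.n) := by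
    rw [mul_pow, s₂_pow hq, ← pow_mul]
  rw [input_G₀, hpow, show P.ϵ * (P.κ q * t ^ (2 * P.germ.n)) =
    P.ϵ * P.κ q * t ^ (2 * P.germ.n) by ring] at h
  rw [← h]
  obtain ⟨k, hk⟩ : ∃ k, P.germ.n = k + 1 := ⟨P.germ.n - 1, by have := P.germ.n_pos; omega⟩
  have hκ : P.κ q = P.s₂ q ^ P.germ.n := (s₂_pow hq).symm
  rw [hκ, hk]
  simp only [Nat.add_sub_cancel, show 2 * (k + 1) - 1 = 2 * k + 1 by omega]
  push_cast
  ring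

/-- **The period integrand vanishes at `t = 0`.** -/
theorem pathIntegrand_zero : soloInformedPathIntegrand (symbol hq) 0 = 0 := by
  unfold soloInformedPathIntegrand
  rw [(datum hq).symbol_integrand soloInformed_hK_Qbar, (hasDerivAt_s hq 0).deriv]
  simp

/-- The period integrand is real on `[0, 2)`. -/
theorem pathIntegrand_im {t : ℝ} (ht : t ∈ Ioo (-((1 : ℚ) : ℝ)) (1 + (1 : ℚ))) (ht0 : 0 ≤ t) :
    (soloInformedPathIntegrand (symbol hq) t).im = 0 := by
  rcases ht0.eq_or_lt with h | h
  · rw [← h, pathIntegrand_zero]; simp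
  · rw [pathIntegrand_eq hq ht h.ne', Complex.ofReal_im]

/-- The one-sided segment `side(c₀, q)` lies in the arc. -/
theorem side_subset : soloInformedSide P.c₀ q P.ϵ ⊆ P.ρ.domain := by
  intro y hy
  rw [P.dom, soloInformed_mem_Ioo1]
  have hκη : P.κ q < P.η := by
    have h1 := hq.2
    have h2 : P.s₂ q ^ P.germ.n ≤ P.s₂ q := pow_le_of_le_one (s₂_pos hq).le
      (by linarith [P.germ.r_le_one, s₂_pos hq]) P.germ.n_pos.ne'
    have h3 : P.s₂ q < P.germ.r := by linarith [s₂_pos hq]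
    have h4 := P.germ.pow_lt (P.s₂ q) ⟨s₂_pos hq, h3⟩
    rw [s₂_pow hq] at h4
    exact h4
  rcases P.sign with h | h
  · have hy' := hy
    rw [h, soloInformed_mem_side_one] at hy'
    have hκ : P.κ q = q - P.c₀ := by simp [κ, h]
    have := P.side (y 0 - P.c₀) ⟨by linarith [hy'.1], by linarith [hy'.2]⟩
    rw [h] at this
    simpa using this
  · have hy' := hy
    rw [h, soloInformed_mem_side_neg_one] at hy'
    have hκ : P.κ q = P.c₀ - q := by simp [κ, h]
    have := P.side (P.c₀ - y 0) ⟨by linarith [hy'.2], by linarith [hy'.1]⟩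
    rw [h] at this
    simpa using this

/-- The restricted representation `[side(c₀, q), g]`. -/
def piece : IntegralRep 1 :=
  P.ρ.restrict _ (isSemialgebraic_soloInformedSide P.c₀_alg (isAlgebraic_algebraMap (q : ℚ)) P.ϵ)
    (side_subset hq)

/-- **`κ̃` of a cusp piece is `(⟦[side(c₀, q), g]⟧, 0)`.** -/
theorem kappaTilde_eq :
    soloInformedKappaTilde (symbol hq) (nash hq) =
      SoloInformedV.mk (toFormalPeriod (of (piece hq))) 0 := by
  have hn2 : 0 < 2 * P.germ.n := by have := P.germ.n_pos; omega
  refine SoloInformedV.ext ?_ ?_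
  · rw [soloInformedKappaTilde_fst, SoloInformedV.fst_mk, toFormalPeriod_eq_iff]
    set R₀ := soloInformedPathRepRe (symbol hq) (nash hq) with hR₀
    have hEr : soloInformedIoo1 ((0 : ℚ) : ℝ) ((1 : ℚ) : ℝ) ⊆ R₀.domain := by
      intro x hx
      rw [hR₀, soloInformedPathRepRe_domain]
      simp only [soloInformed_mem_Ioo1, Rat.cast_zero, Rat.cast_one] at hx
      exact ⟨hx.1.le, hx.2.le⟩
    set R₁ := R₀.restrict _ (isSemialgebraic_soloInformedIoo1 0 1) hEr with hR₁
    have e₀ : of R₀ - of R₁ ∈ relations :=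
      R₀.of_sub_of_restrict_mem_relations _ hEr (by
        rw [hR₀, soloInformedPathRepRe_domain]; exact SoloInformedGoodPiece.volume_unitI_diff)
    have hdom : R₁.domain = {t : Fin 1 → ℝ | t 0 ∈ Ioo (0 : ℝ) 1} := by
      rw [hR₁, IntegralRep.domain_restrict]
      ext x
      simp [soloInformed_mem_Ioo1]
    have e₁ : of R₁ - of (piece hq) ∈ changeOfVariablesRel := by
      refine soloInformed_powMove P.c₀_alg (P.κ_alg q) hq.1 P.sign hn2 R₁ (piece hq) hdom ?_ ?_
      · rw [hdom, soloInformed_powMap_image hq.1 P.sign hn2, c₀_add]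
        rfl
      · intro x hx
        rw [hdom] at hx
        simp only [mem_setOf_eq] at hx
        have hxS : x 0 ∈ Ioo (-((1 : ℚ) : ℝ)) (1 + (1 : ℚ)) := by
          simp only [Rat.cast_one]; constructor <;> linarith [hx.1, hx.2]
        rw [hR₁, IntegralRep.integrand_restrict, hR₀, soloInformedPathRepRe_integrand]
        show (soloInformedPathIntegrand (symbol hq) (x 0)).re = _
        rw [pathIntegrand_eq hq hxS hx.1.ne', Complex.ofReal_re]
        show _ = (piece hq).integrand _ * _
        rw [piece, IntegralRep.integrand_restrict, soloInformed_integrand_eq_arcFun,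
          soloInformedPowMap_apply]
        rfl
    have : of R₀ - of (piece hq) = (of R₀ - of R₁) + (of R₁ - of (piece hq)) := by abel
    rw [this]
    exact add_mem e₀ (changeOfVariablesRel_subset_relations e₁)
  · rw [soloInformedKappaTilde_snd, SoloInformedV.snd_mk]
    refine toFormalPeriod_eq_zero_of_mem (of_mem_relations_of_eqOn_zero _ fun x hx => ?_)
    rw [soloInformedPathRepIm_integrand]
    show (soloInformedPathIntegrand (symbol hq) (x 0)).im = 0
    rw [soloInformedPathRepIm_domain] at hx
    have hx' : (0 : ℝ) ≤ x 0 ∧ x 0 ≤ 1 := hx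
    exact pathIntegrand_im hq (by simp only [Rat.cast_one]; constructor <;> linarith [hx'.1, hx'.2])
      hx'.1

end SoloInformedCuspPiece

end Summit.KontsevichZagierPeriods.KontsevichZagierPeriods.Theorems
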